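import Summits.CriticalPhenomena.PercolationContinuityZ3.Theorems.PercNearOneGluingNoHeavyLowerTailSahiCombTriangleThinEdge
import Summits.CriticalPhenomena.PercolationContinuityZ3.Theorems.PercNearOneGluingNoHeavyLowerTailSahiCombFiveUpSetProof

/-!
# The comb hierarchy for Sahi's `E_k`: the thin-edge cells of the triangle class — UNCONDITIONAL

Support file of the one-cut programme (crux `NoHeavyLowerTail`, stmt-CriticalPhenomena-4575; cell `prim-masterthm`, seat P5 gen 8;
report `P5-LORENTZIAN-TEST.md` §13).  The one-cube five-up-set inequality `FiveUpSet.FiveUpSetIneq` is now a tree theorem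
(`FiveUpSet.fiveUpSetIneq_holds`, prim-lf-1 gen 18, rank form (RANK-Z)); this file discharges the hypothesis `h5` of
`…SahiCombTriangleThinEdge` and of `…SahiCombFiveUpSetProduct`:

* `LatticeFiveUpSet.triWOne_nonneg_prod'` — `TRI_W ≥ 0` at a thin edge on every product cube `Finset β × Finset γ`;
* `SahiHybrid.hybCoeff_nonneg_of_thinEdge'`, `combPos_thinEdge'`, **`sahiE_three_nonneg_thinEdge'`** — (M⁺⁺-3) and Sahi positivity
  `E_3(μ_p; 1_{U_0}, 1_{U_1}, 1_{U_2}) ≥ 0` for every product measure and every triple of increasing events with no triply-pivotal coordinate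
  and at most one coordinate pivotal for both `U_0` and `U_1` — UNCONDITIONALLY.
HONEST LABEL: one proved stratum (thin-edge triangle class); (M⁺⁺-3) in general and `C_3` stay OPEN. [this work]
-/

noncomputable section

open scoped Classical

namespace Summit.CriticalPhenomena.PercolationContinuityZ3.Theorems

open Finset Function
open Literature.Combinatorics.Sahi2008
open Literature.Probability.Percolation (DeterminedBy)
open Literature.Probability.Percolation.DecisionTree (ind)
open SahiComb LatticeFiveUpSet

/-- **`TRI_W ≥ 0` at a thin edge on the product cube `2^β × 2^γ`**, unconditionally. [this work] -/
theorem LatticeFiveUpSet.triWOne_nonneg_prod' (β γ : Type) [DecidableEq β] [Fintype β] [DecidableEq γ] [Fintype γ]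
    (P F₀ F₁ G₀ G₁ : Finset (Finset β × Finset γ))
    (hP : IsUpperSet (P : Set (Finset β × Finset γ))) (hF₀ : IsUpperSet (F₀ : Set (Finset β × Finset γ)))
    (hF₁ : IsUpperSet (F₁ : Set (Finset β × Finset γ))) (hG₀ : IsUpperSet (G₀ : Set (Finset β × Finset γ)))
    (hG₁ : IsUpperSet (G₁ : Set (Finset β × Finset γ))) (hF : F₀ ⊆ F₁) (hG : G₀ ⊆ G₁) :
    0 ≤ triWOne (prodCompl β γ) P F₀ F₁ G₀ G₁ :=
  triWOne_nonneg_prod FiveUpSet.fiveUpSetIneq_holds β γ P F₀ F₁ G₀ G₁ hP hF₀ hF₁ hG₀ hG₁ hF hG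

namespace SahiHybrid

variable {ι : Type} [Fintype ι]

/-- **(M⁺⁺-3) coefficients on the thin-edge cells of the triangle class are `≥ 0`**, unconditionally. [this work] -/
theorem hybCoeff_nonneg_of_thinEdge' {E : Fin 3 → Finset ι} (hT : IsClassT E) (hthin : (E 0 ∩ E 1).card ≤ 1)
    (U : Fin 3 → Set (Set ι)) (hU : ∀ i, DeterminedBy (U i) ↑(E i)) (hmono : ∀ i, IsUpperSet (U i)) (s : ι → ℕ) :
    0 ≤ hybCoeff E U s :=
  hybCoeff_nonneg_of_thinEdge FiveUpSet.fiveUpSetIneq_holds hT hthin U hU hmono s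

/-- **(M⁺⁺-3) — comb positivity at the minimal multidegree — for every thin-edge class-T triple of increasing events**, unconditionally. [this work] -/
theorem combPos_thinEdge' (U : Fin 3 → Set (Set ι)) (hmono : ∀ i, IsUpperSet (U i)) (hT : IsClassT fun i => esupp (U i))
    (hthin : (esupp (U 0) ∩ esupp (U 1)).card ≤ 1) :
    CombPos (minDeg fun i => esupp (U i)) (fun p => sahiE (bernoulliWeight p) 3 (fun i => ind (U i))) :=
  combPos_thinEdge FiveUpSet.fiveUpSetIneq_holds U hmono hT hthin

/-- **Sahi positivity `E_3(μ_p; 1_{U_0}, 1_{U_1}, 1_{U_2}) ≥ 0` for every product measure on the thin-edge cells of the triangle class**,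
unconditionally: three increasing events on a finite cube, no coordinate pivotal for all three, at most one coordinate pivotal for both
`U_0` and `U_1`. [this work] -/
theorem sahiE_three_nonneg_thinEdge' (U : Fin 3 → Set (Set ι)) (hmono : ∀ i, IsUpperSet (U i)) (hT : IsClassT fun i => esupp (U i))
    (hthin : (esupp (U 0) ∩ esupp (U 1)).card ≤ 1) (p : ι → unitInterval) :
    0 ≤ sahiE (bernoulliWeight p) 3 (fun i => ind (U i)) :=
  sahiE_three_nonneg_thinEdge FiveUpSet.fiveUpSetIneq_holds U hmono hT hthin p

end SahiHybrid

end Summit.CriticalPhenomena.PercolationContinuityZ3.Theorems
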